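import Literature.NumberTheory.EllipticCurves.TateModuleFree
import Literature.NumberTheory.EllipticCurves.DivisionPolynomialTorsion
import HarnessLib

/-!
# The Tate module of an elliptic curve is free of finite rank over `ℤ_p` (discharges)

Pure-proof sibling of `Literature.NumberTheory.EllipticCurves.TateModule` (the named facts
`WeierstrassCurve.module_free_tateModule` / `WeierstrassCurve.module_finite_tateModule`,
Silverman, *AEC*, Prop. III.7.1) and of `TateModuleFree.lean` (the reduction of both facts to the
finiteness of the geometric `p`-torsion `E(F̄)[p]`).

Silverman's printed proof of Prop. III.7.1 is one line: "This follows immediately from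
(III.6.4b,c)", i.e. from the structure of `E[m]`. The Lean route assembled here is uniform in the
prime `p` (it covers `p = char F` as well) and uses only the *finiteness* half of III.6.4:

1. `E(F̄)[n]` is finite for `n ≠ 0` (Silverman, *AEC*, Cor. III.6.4) — proved unconditionally, in
   all characteristics, as `WeierstrassCurve.finite_torsionBy_baseChange`
   (`DivisionPolynomialTorsion.lean`); recorded below as the instance
   `finite_torsionPoints_algebraicClosure` of the named fact `finite_torsionPoints`
   (`GaloisAction.lean`).
2. For any abelian group `A` and prime `p` with `A[p]` finite, `T_p A = lim A[p^k]` is a finitely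
   generated free `ℤ_p`-module (`Literature.NumberTheory.EllipticCurves.TateModule.free_of_finite_torsionBy`, `TateModuleFree.lean`:
   `T_p A` is `p`-adically separated and torsion-free, `T_p A / p ↪ A[p]` is finite, so finitely
   many lifts generate by Nakayama over the `p`-adically complete ring `ℤ_p`, and a finitely
   generated torsion-free module over the PID `ℤ_p` is free).

Hence `module_finite_tateModule_holds` and `module_free_tateModule_holds`.

## References

* J. H. Silverman, *The Arithmetic of Elliptic Curves*, 2nd ed., GTM 106, Springer (2009),
  Prop. III.7.1 (held PDF p. 83) and Cor. III.6.4 (held PDF pp. 81–82). [SilvermanAEC2009]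
-/

noncomputable section

open scoped Classical

universe u

namespace WeierstrassCurve

variable {F : Type u} [Field F] (W : WeierstrassCurve F) (p : ℕ) [Fact p.Prime]

/-- The geometric torsion `E(F̄)[n]`, `n ≠ 0`, of an elliptic curve `E/F` is finite: the instance
`L = F̄` of the named fact `finite_torsionPoints W L` of `GaloisAction.lean` (Silverman, *AEC*,
Cor. III.6.4), supplied by `WeierstrassCurve.finite_torsionBy_baseChange`
(`DivisionPolynomialTorsion.lean`, all characteristics). [cite: SilvermanAEC2009, Cor. III.6.4] -/
theorem finite_torsionPoints_algebraicClosure : finite_torsionPoints W (AlgebraicClosure F) :=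
  fun hn => finite_torsionBy_baseChange W (AlgebraicClosure F) hn

/-- **Silverman, AEC, Prop. III.7.1 (finite generation of the Tate module)**, discharged: for an
elliptic curve `E/F` and *every* prime `p` (including `p = char F`), `T_p E` is a finitely
generated `ℤ_p`-module. [cite: SilvermanAEC2009, Prop. III.7.1] -/
theorem module_finite_tateModule_holds : module_finite_tateModule W p :=
  module_finite_tateModule_of_finite_torsionPoints W p (finite_torsionPoints_algebraicClosure W)

/-- **Silverman, AEC, Prop. III.7.1 (the Tate module is free over `ℤ_p`)**, discharged: for an
elliptic curve `E/F` and *every* prime `p`, `T_p E` is a free `ℤ_p`-module (`≅ ℤ_p × ℤ_p` for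
`p ≠ char F` by III.7.1(a); `0` or `ℤ_p` for `p = char F > 0` by III.7.1(b) — free in every case).
The proof is uniform in `p`: `E(F̄)[p]` finite (Cor. III.6.4) ⇒ `T_p E` finitely generated
(Nakayama over the complete ring `ℤ_p`) and torsion-free over the PID `ℤ_p`, hence free.
[cite: SilvermanAEC2009, Prop. III.7.1(a),(b)] -/
theorem module_free_tateModule_holds : module_free_tateModule W p :=
  module_free_tateModule_of_finite_torsionPoints W p (finite_torsionPoints_algebraicClosure W)

end WeierstrassCurve
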